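import Literature.MathematicalPhysics.QuantumManyBody.PeriodicBoseGas
import HarnessLib

/-!
# Boccato–Brennecke–Cenatiempo–Schlein (2019/2020): optimal-rate Bose–Einstein condensation in
the Gross–Pitaevskii regime (Theorem 1.1)

Topic `Literature/MathematicalPhysics/QuantumManyBody`. Named fact (Literature is sorry-free;
users take `(h : BoccatoEtAl2019_optimalRate_GP)`); vendored by a grounder for route
`BECModePrice` of the conjunct `BoseEinsteinCondensation` (summit `AtomisticToContinuum`).

Source: C. Boccato, C. Brennecke, S. Cenatiempo, B. Schlein, *Optimal Rate for Bose–Einstein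
Condensation in the Gross–Pitaevskii Regime*, Comm. Math. Phys. **376** (2020) 1311–1395 =
arXiv:1812.03086 [cite: BoccatoEtAl2019]. Setting (§1, pp. 2–3 of the arXiv version): `N`
bosons in the box `Λ = [0;1]³` with PERIODIC boundary conditions,
`H_N = ∑ⱼ -Δ_{xⱼ} + ∑_{i<j} N² V(N(xᵢ - xⱼ))` on `L²_s(Λ^N)` (eq. (1.1)), `V ∈ L³(ℝ³)`
non-negative, radial, compactly supported, scattering length `𝔞₀` of the unscaled `V` through
`(-Δ + ½V) f = 0`, `f → 1` (eq. (1.2)–(1.3); units `ħ = 2m = 1`, the tree's, cf. the companion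
fact `BoccatoEtAl2019Acta_firstExcitation` of `BogoliubovSpectrumGP.lean` where the same
convention gives the dispersion `√(|p|⁴ + 16π𝔞₀p²)`), `φ₀ ≡ 1` the zero-momentum mode,
`γ_N` the one-particle reduced density matrix normalised to trace one.

**Theorem 1.1 (p. 3, verbatim).** *"Let `V ∈ L³(ℝ³)` have compact support and be pointwise
non-negative. Then there exists a constant `C > 0` such that the ground state energy `E_N` of
(1.1) satisfies `|E_N - 4π𝔞₀N| ≤ C` (1.5). Furthermore, consider a sequence `ψ_N ∈ L²_s(Λ^N)`
with `‖ψ_N‖ = 1` and such that `⟨ψ_N, H_N ψ_N⟩ ≤ 4π𝔞₀N + K` for a `K > 0`. Then the reduced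
density matrix `γ_N = tr_{2,…,N} |ψ_N⟩⟨ψ_N|` associated with `ψ_N` is such that
`1 - ⟨φ₀, γ_N φ₀⟩ ≤ C(K+1)/N` (1.6) for all `N ∈ ℕ` large enough."* Remark after the theorem
(pp. 3–4): (1.6) says `N[1 - ⟨φ₀, γ_N φ₀⟩] ≤ C(K+1)`, "for low-energy states `ψ_N` with finite
excess energy `K`, the number of excitations of the Bose–Einstein condensate remains bounded,
uniformly in `N`".

Rendering in the tree's periodic-box vocabulary (`PeriodicBoseGas.lean`), unit torus `L = 1`:
* the potential is a radial profile `V : ℝ → ℝ≥0∞` (`V(x) = V(|x|)`; non-negativity and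
  radiality built in), measurable, of finite range, with `∫ V(|x|)³ dx < ∞` (`V ∈ L³`); the
  Gross–Pitaevskii scaling is written inline, `V_N(r) = N² V(N r)` (this is
  `gpScaledPotential V N` of `BogoliubovSpectrumGP.lean`, not imported to keep the cone small,
  and verbatim the `let VN` of route item `BECModePrice.GPWindowModePrice`);
* `E_N = periodicGroundStateEnergy V_N N 1` (infimum of the periodic form over the `C¹`
  periodic Bose-symmetric normalised core — equal to `inf spec H_N`); the periodised interaction
  `∑_n V_N(|x - n|)` is the paper's torus interaction (range `R₀/N < ½` for `N` large);
* `𝔞₀ = (scatteringLength V).toReal` (finite: `V ∈ L³` with compact support is integrable,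
  `scatteringLength_ne_top`);
* (1.6) is recorded as `N ≤ ⟨Ψ, n₀ Ψ⟩ + C(K+1)` in `ℝ≥0∞`, with
  `⟨Ψ, n₀ Ψ⟩ = condensateOccupation N 1 Ψ.ψ = N⟨φ₀, γ_Ψ φ₀⟩` (`≤ N`), for every periodic trial
  state `Ψ` (a subset of the paper's normalised `ψ_N ∈ L²_s(Λ^N)` of finite energy);
* quantifier placement: (1.6) is PRINTED for sequences `(ψ_N)` "for all `N` large enough";
  the proof (§6: Prop. 6.1, eq. (6.1) `𝒢_{N,ℓ} - 4π𝔞₀N ≥ c𝒩₊ - C` "for all `N ∈ ℕ`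
  sufficiently large", an OPERATOR inequality, and "Proof of Theorem 1.1", p. 16:
  `⟨ξ_N, 𝒩₊ ξ_N⟩ ≤ C⟨ξ_N,(𝒢_{N,ℓ} - 4π𝔞₀N)ξ_N⟩ + C ≤ C(K+1)` for EVERY `ψ_N` with the energy
  hypothesis) gives `C` and the threshold `N₀` depending on `V` only, uniformly in `K > 0` and
  in the state; this uniform form — the one every user needs — is the form recorded
  (`∃ C N₀, ∀ N ≥ N₀, … ∧ ∀ K > 0, ∀ Ψ, …`).

Relation to the summit routes: nearest PROVED print to
`Summit.AtomisticToContinuum.BoseEinsteinCondensation.Theses.BECModePrice.GPWindowModePrice`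
(stmt-AtomisticToContinuum-18515), which asks, in the same GP window, for the single-mode
KINETIC price `E_N + ½|2πp|² n_p(Ψ) ≤ ⟨Ψ, H_N Ψ⟩ + C` uniformly in `p ≠ 0`: from (1.5)–(1.6),
`n_p(Ψ) ≤ N - ⟨Ψ,n₀Ψ⟩ ≤ C(⟨Ψ,H_NΨ⟩ - 4π𝔞₀N + 1) ≤ C(⟨Ψ,H_NΨ⟩ - E_N + C + 1)`, i.e. the item
with the mode weight `½|2πp|²` replaced by the constant `C⁻¹` — the item is STRONGER for
`|p| → ∞` (it needs `n_p ≲ (excess + 1)/|p|²` on the physical state) and is recorded as such;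
and the Gross–Pitaevskii anchor of the thermodynamic-limit cruxes `ModePriceIntegrable` /
`ModePriceHardCore` (stmt-18512/18513). A DEFINITION of the statement (named fact,
review-queued), no proof.

## Mathlib / tree search

Mathlib has no Bose gas / BEC theory. Tree (`lean search`): `BoccatoEtAl2019Acta_firstExcitation`,
`BoccatoEtAl2019_firstGap_GP` (spectral part of the Acta paper's Thm 1.1 only),
`Fournais2020_condensation` (length scales beyond GP, different window), `LSSY2005_*` energy
bounds; no condensate-depletion bound in the GP window was present.

## References

* [BoccatoEtAl2019] C. Boccato, C. Brennecke, S. Cenatiempo, B. Schlein, *Optimal Rate for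
  Bose–Einstein Condensation in the Gross–Pitaevskii Regime*, Comm. Math. Phys. 376 (2020)
  1311–1395, doi:10.1007/s00220-019-03555-9, arXiv:1812.03086: Thm. 1.1 (1.5)–(1.6) p. 3,
  Remark pp. 3–4, Prop. 6.1 (6.1) p. 15, Proof of Thm. 1.1 p. 16.
* [BoccatoEtAl2017] — , *Complete Bose–Einstein Condensation in the Gross–Pitaevskii Regime*,
  Comm. Math. Phys. 359 (2018) 975–1026 (the same bounds for small `V`).
* [LSSY2005] E. H. Lieb, R. Seiringer, J. P. Solovej, J. Yngvason, *The Mathematics of the Bose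
  Gas and its Condensation* (2005), Thm. 5.1 (complete BEC in the GP limit, no rate).
-/

noncomputable section

open MeasureTheory Filter
open scoped ENNReal NNReal

namespace Literature.MathematicalPhysics.QuantumManyBody.BoseGas

/-- **Boccato–Brennecke–Cenatiempo–Schlein, Theorem 1.1** (optimal rate for BEC in the
Gross–Pitaevskii regime). *"Let `V ∈ L³(ℝ³)` have compact support and be pointwise
non-negative. Then there exists a constant `C > 0` such that the ground state energy `E_N` of
`H_N = ∑ⱼ -Δ_{xⱼ} + ∑_{i<j} N²V(N(xᵢ - xⱼ))` [unit torus, periodic b.c.] satisfies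
`|E_N - 4π𝔞₀N| ≤ C`. Furthermore, consider … `ψ_N ∈ L²_s(Λ^N)` with `‖ψ_N‖ = 1` and such that
`⟨ψ_N, H_Nψ_N⟩ ≤ 4π𝔞₀N + K` for a `K > 0`. Then … `1 - ⟨φ₀, γ_Nφ₀⟩ ≤ C(K+1)/N` for all `N`
large enough"* — i.e. `N - ⟨ψ_N, n₀ψ_N⟩ ≤ C(K+1)`: the number of excitations of the condensate
is bounded by the excess energy. Recorded on the tree's periodic `C¹` core of the unit torus with
the GP-scaled profile `V_N(r) = N²V(Nr)`, `𝔞₀ = scatteringLength V`, `⟨Ψ,n₀Ψ⟩ =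
condensateOccupation N 1 Ψ.ψ`, and with `C`, `N₀` depending on `V` only (uniform in `K` and in
the state, as the proof via the operator inequality (6.1) gives; see the module docstring).
Grounds `Summit.AtomisticToContinuum.BoseEinsteinCondensation.Theses.BECModePrice.GPWindowModePrice`
as its nearest print (the item is STRONGER: mode weight `½|2πp|²` instead of a constant).
[cite: BoccatoEtAl2019, Thm 1.1] -/
def BoccatoEtAl2019_optimalRate_GP : Prop :=
  ∀ (V : ℝ → ℝ≥0∞), Measurable V → (∫⁻ x : Space, V ‖x‖ ^ 3) ≠ ⊤ →
    (∃ R₀ : ℝ, ∀ r, R₀ < r → V r = 0) →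
    ∃ (C : ℝ) (N₀ : ℕ), ∀ N : ℕ, N₀ ≤ N →
      let a : ℝ := (scatteringLength V).toReal
      let VN : ℝ → ℝ≥0∞ := fun r => (N : ℝ≥0∞) ^ 2 * V ((N : ℝ) * r)
      let E : ℝ≥0∞ := periodicGroundStateEnergy VN N 1
      E ≤ ENNReal.ofReal (4 * Real.pi * a * N + C) ∧
        ENNReal.ofReal (4 * Real.pi * a * N - C) ≤ E ∧
        ∀ K : ℝ, 0 < K → ∀ Ψ : PeriodicTrialState N 1,
          periodicEnergy VN Ψ ≤ ENNReal.ofReal (4 * Real.pi * a * N + K) →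
            (N : ℝ≥0∞) ≤ condensateOccupation N 1 Ψ.ψ + ENNReal.ofReal (C * (K + 1))

/-- The depletion form of (1.6): under `BoccatoEtAl2019_optimalRate_GP`, for `N ≥ N₀` and a
periodic trial state of energy `≤ 4π𝔞₀N + K`, the expected number of particles outside the
constant mode satisfies `N - ⟨Ψ, n₀Ψ⟩ ≤ C(K+1)` (truncated subtraction in `ℝ≥0∞`).
[cite: BoccatoEtAl2019, Thm 1.1 and Remark (1.7)] -/
theorem BoccatoEtAl2019_optimalRate_GP.depletion_le (h : BoccatoEtAl2019_optimalRate_GP)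
    {V : ℝ → ℝ≥0∞} (hV : Measurable V) (hL3 : (∫⁻ x : Space, V ‖x‖ ^ 3) ≠ ⊤)
    (hR : ∃ R₀ : ℝ, ∀ r, R₀ < r → V r = 0) :
    ∃ (C : ℝ) (N₀ : ℕ), ∀ N : ℕ, N₀ ≤ N → ∀ K : ℝ, 0 < K → ∀ Ψ : PeriodicTrialState N 1,
      periodicEnergy (fun r => (N : ℝ≥0∞) ^ 2 * V ((N : ℝ) * r)) Ψ ≤
          ENNReal.ofReal (4 * Real.pi * (scatteringLength V).toReal * N + K) →
        (N : ℝ≥0∞) - condensateOccupation N 1 Ψ.ψ ≤ ENNReal.ofReal (C * (K + 1)) := by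
  obtain ⟨C, N₀, hN⟩ := h V hV hL3 hR
  refine ⟨C, N₀, fun N hN₀ K hK Ψ hΨ => ?_⟩
  have h3 := (hN N hN₀).2.2 K hK Ψ hΨ
  exact tsub_le_iff_right.mpr (by simpa [add_comm] using h3)

end Literature.MathematicalPhysics.QuantumManyBody.BoseGas

end
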